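import Summits.QuantumFields.YangMills.Theses.ParabolicTrajectory
import Literature.MathematicalPhysics.QuantumFieldTheory.LatticeGaugeProofs

/-!
# `LatticeGapOnTrajectory` — negative-side support: shape lemmas and zero-coupling ultralocality

Support file for crux `stmt-QuantumFields-10523` (`ParabolicTrajectory.LatticeGapOnTrajectory`, conjunct (B)) and
its sibling (S) `TunedSequenceExists`, extracted from the standing disprover's work file
`Cruxes/LatticeGapOnTrajectory/Disproof.lean` (§1, §4b). All statements are about the tree's OWN objects
(`SpeciesScheme`, `wilsonMeasure`, `latticeConnectedCorr`, `LatticeRep.curvature`); nothing is posited.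

* `two_le_of_shape`, `tendsto_natPow_of_shape`, `tendsto_n_of_shape`, `eventually_sep_le_L`: the `M`-adic shape
  `a_k = M^{-n_k}` plus the scheme axioms force `2 ≤ M`, `M^{n_k} → ∞`, `n_k → ∞`, `M^{n_k} ≤ L_k` eventually.
* `wilsonMeasure_zero_coupling`: at `β = 0` the torus Wilson measure is the product Haar measure.
* `integral_mul_eq_of_dependsOn_disjoint`: under a product probability measure, measurable real functions of
  disjoint coordinate sets are uncorrelated (Mathlib `iIndepFun_pi`).
* `latticeConnectedCorr_zero_coupling`, `disjoint_curvature_torusSupports`, `curvatureCorr_zero_coupling_eventually`: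
  `⟨P ; τ_{M^{n_k}} P⟩_{β = 0} = 0` exactly, eventually along every `M`-adic scheme (the IVT endpoint of (S)).
* `not_tuning_of_eventually_zero_coupling`: no scheme with `β_k = 0` eventually meets the tuning with `θ ≠ 0`.
-/

namespace Summit.QuantumFields.YangMills.Theorems.LatticeGapOnTrajectory.Negative

open Filter Topology MeasureTheory ProbabilityTheory
open Literature.MathematicalPhysics.QuantumFieldTheory Literature.MathematicalPhysics.QuantumLattice

noncomputable section

section Shape

variable {ι : Type}

/-- The `M`-adic shape `a_k = M^{-n_k}` together with the scheme axioms `a_k > 0`, `a_k → 0` already forces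
`2 ≤ M`: for `M = 1` the spacing is constant `1`, for `M = 0` it is `1` (if `n_k = 0`) or the junk value `0⁻¹ = 0`
(excluded by `a_pos`). Hence the crux's hypothesis `2 ≤ M` is decoration. [folklore] -/
theorem two_le_of_shape (sch : SpeciesScheme ι) {M : ℕ} {n : ℕ → ℕ}
    (h : ∀ k, sch.a k = ((M : ℝ) ^ n k)⁻¹) : 2 ≤ M := by
  by_contra hM
  push Not at hM
  have ha : ∀ k, sch.a k = 1 := by
    intro k
    have hk := h k
    have hpos := sch.a_pos k
    interval_cases M
    · rcases Nat.eq_zero_or_pos (n k) with h0 | h0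
      · simpa [h0] using hk
      · exfalso
        rw [hk] at hpos
        simp [h0.ne'] at hpos
    · simpa using hk
  have h1 : Tendsto sch.a atTop (𝓝 (1 : ℝ)) := by
    have : sch.a = fun _ => (1 : ℝ) := funext ha
    rw [this]
    exact tendsto_const_nhds
  have := tendsto_nhds_unique h1 sch.tendsto_a
  norm_num at this

/-- Under the shape hypothesis the tuned separation `M^{n_k} = a_k⁻¹` tends to infinity (in lattice units).
[folklore] -/
theorem tendsto_natPow_of_shape (sch : SpeciesScheme ι) {M : ℕ} {n : ℕ → ℕ}
    (h : ∀ k, sch.a k = ((M : ℝ) ^ n k)⁻¹) :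
    Tendsto (fun k => ((M : ℝ) ^ n k)) atTop atTop := by
  have hpos : Tendsto sch.a atTop (𝓝[>] (0 : ℝ)) :=
    tendsto_nhdsWithin_iff.2 ⟨sch.tendsto_a, Eventually.of_forall fun k => sch.a_pos k⟩
  have hinv : Tendsto (fun k => (sch.a k)⁻¹) atTop atTop := tendsto_inv_nhdsGT_zero.comp hpos
  refine hinv.congr fun k => ?_
  rw [h k, inv_inv]

/-- Under the shape hypothesis the exponents `n_k` tend to infinity. [folklore] -/
theorem tendsto_n_of_shape (sch : SpeciesScheme ι) {M : ℕ} {n : ℕ → ℕ}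
    (h : ∀ k, sch.a k = ((M : ℝ) ^ n k)⁻¹) : Tendsto n atTop atTop := by
  have hM := two_le_of_shape sch h
  have hpow := tendsto_natPow_of_shape sch h
  rw [tendsto_atTop_atTop] at hpow ⊢
  intro N
  obtain ⟨K, hK⟩ := hpow ((M : ℝ) ^ N + 1)
  refine ⟨K, fun k hk => ?_⟩
  by_contra hlt
  push Not at hlt
  have h1 : (1 : ℝ) ≤ M := by exact_mod_cast (by omega : 1 ≤ M)
  have hle : (M : ℝ) ^ n k ≤ (M : ℝ) ^ N := pow_le_pow_right₀ h1 hlt.le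
  have := hK k hk
  linarith

/-- No wrap-around: eventually `M^{n_k} ≤ L_k`, so the tuned two-point function at separation `M^{n_k}` on the
torus of side `2L_k + 1` is an honest (non-periodic-image) correlation at physical distance `1`. [folklore] -/
theorem eventually_sep_le_L (sch : SpeciesScheme ι) {M : ℕ} {n : ℕ → ℕ}
    (h : ∀ k, sch.a k = ((M : ℝ) ^ n k)⁻¹) : ∀ᶠ k in atTop, M ^ n k ≤ sch.L k := by
  have hM := two_le_of_shape sch h
  filter_upwards [sch.tendsto_L.eventually_ge_atTop 1] with k hk
  rw [h k] at hk
  have hc : (0 : ℝ) < (M : ℝ) ^ n k := by positivity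
  have := (le_inv_mul_iff₀ hc).1 hk
  rw [mul_one] at this
  exact_mod_cast this

end Shape

section ProductMeasure

/-- **Ultralocality of a product measure.** Under a product probability measure, measurable real functions
depending on DISJOINT finite sets of coordinates are uncorrelated: `∫ f g = ∫ f · ∫ g`. [folklore] -/
theorem integral_mul_eq_of_dependsOn_disjoint {κ G : Type*} [Fintype κ] [DecidableEq κ] [One G]
    [MeasurableSpace G] (ν : Measure G) [IsProbabilityMeasure ν]
    {f g : (κ → G) → ℝ} (I J : Finset κ) (hIJ : Disjoint I J)
    (hf : DependsOn f (↑I : Set κ)) (hg : DependsOn g (↑J : Set κ))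
    (hfm : Measurable f) (hgm : Measurable g) :
    ∫ U, f U * g U ∂(Measure.pi fun _ : κ => ν) =
      (∫ U, f U ∂(Measure.pi fun _ : κ => ν)) * ∫ U, g U ∂(Measure.pi fun _ : κ => ν) := by
  -- measurable sections ("pad by 1") of the two restriction maps
  have hpad : ∀ K : Finset κ, ∃ pad : (↥K → G) → κ → G,
      Measurable pad ∧ ∀ U : κ → G, ∀ e ∈ (↑K : Set κ), pad (K.restrict U) e = U e := by
    intro K
    refine ⟨fun u e => if h : e ∈ K then u ⟨e, h⟩ else 1, ?_, ?_⟩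
    · refine measurable_pi_lambda _ fun e => ?_
      by_cases he : e ∈ K
      · simp only [he, dite_true]; exact measurable_pi_apply _
      · simp only [he, dite_false]; exact measurable_const
    · intro U e he
      simp [Finset.mem_coe.1 he]
  obtain ⟨padI, hmI, hI⟩ := hpad I
  obtain ⟨padJ, hmJ, hJ⟩ := hpad J
  have hind : iIndepFun (fun (e : κ) (U : κ → G) => U e) (Measure.pi fun _ : κ => ν) :=
    iIndepFun_pi (X := fun _ : κ => @id G) fun _ => aemeasurable_id
  have hIJ' : IndepFun (fun (U : κ → G) (i : ↥I) => U i) (fun (U : κ → G) (j : ↥J) => U j)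
      (Measure.pi fun _ : κ => ν) :=
    hind.indepFun_finset I J hIJ fun e => measurable_pi_apply e
  have hcomp : IndepFun ((f ∘ padI) ∘ fun (U : κ → G) (i : ↥I) => U i)
      ((g ∘ padJ) ∘ fun (U : κ → G) (j : ↥J) => U j) (Measure.pi fun _ : κ => ν) :=
    hIJ'.comp (hfm.comp hmI) (hgm.comp hmJ)
  have hf' : ((f ∘ padI) ∘ fun (U : κ → G) (i : ↥I) => U i) = f := by
    funext U; exact hf (hI U)
  have hg' : ((g ∘ padJ) ∘ fun (U : κ → G) (j : ↥J) => U j) = g := by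
    funext U; exact hg (hJ U)
  rw [hf', hg'] at hcomp
  have := hcomp.integral_mul_eq_mul_integral hfm.aestronglyMeasurable hgm.aestronglyMeasurable
  simpa using this

end ProductMeasure

section Cylinder

variable {G : Type}

/-- A cylinder observable of the infinite lattice, evaluated on periodic lifts, depends only on the torus edges
below its support. [folklore] -/
theorem dependsOn_comp_torusLift {α : Type*} {F : LGConfig 4 G → α} {SF : Finset (Literature.MathematicalPhysics.QuantumLattice.ZdEdge 4)}
    (hF : IsCylinder F SF) (S : ℕ) :
    DependsOn (fun U : GaugeConfig 4 S G => F (torusLift S U))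
      (↑(SF.image (torusEdge S)) : Set (Edge 4 S)) := by
  intro U V hUV
  refine hF fun e he => ?_
  simp only [torusLift, Function.comp_apply]
  exact hUV (torusEdge S e) (Finset.mem_coe.2 (Finset.mem_image_of_mem _ (Finset.mem_coe.1 he)))

end Cylinder

section ZeroCoupling

variable {G : Type} [Group G] [TopologicalSpace G] [IsTopologicalGroup G] [CompactSpace G]
  [MeasurableSpace G] [BorelSpace G]

/-- At zero coupling the Wilson measure IS the product Haar measure (density `e⁰ = 1`, `Z = 1`). [folklore] -/
theorem wilsonMeasure_zero_coupling {N : ℕ} (ρ : G →* Matrix (Fin N) (Fin N) ℂ) (S : ℕ) [NeZero S] :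
    wilsonMeasure (d := 4) (L := S) ρ 0 = Measure.pi fun _ : Edge 4 S => haarProbability G := by
  have hW : wilsonWeight (d := 4) (L := S) ρ 0 = Measure.pi fun _ : Edge 4 S => haarProbability G := by
    have h1 : (fun U : GaugeConfig 4 S G => ENNReal.ofReal (Real.exp (-0 * wilsonAction ρ U))) = 1 := by
      funext U; simp
    simp only [wilsonWeight, h1, withDensity_one]
  have hZ : partitionFunction (d := 4) (L := S) ρ 0 = 1 := by
    simp only [partitionFunction, hW, measure_univ]
  rw [wilsonMeasure, hZ, hW, inv_one, one_smul]

/-- Torus Wilson expectations are invariant under the time translation used in `latticeConnectedCorr`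
(tree: `wilsonExpectation_comp_torusConfigShift` + `toTorusObservable_comp_configShift`). [folklore] -/
theorem integral_comp_configShift_torusLift {N : ℕ} (ρ : G →* Matrix (Fin N) (Fin N) ℂ) (β : ℝ) (S : ℕ)
    [NeZero S] (B : LGConfig 4 G → ℝ) (v : Literature.Probability.LatticeModels.Site 4) :
    ∫ U, B (configShift v (torusLift S U)) ∂(wilsonMeasure (d := 4) (L := S) ρ β) =
      ∫ U, B (torusLift S U) ∂(wilsonMeasure (d := 4) (L := S) ρ β) := by
  have h := wilsonExpectation_comp_torusConfigShift (d := 4) (L := S) ρ β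
    (Literature.Probability.LatticeModels.Torus.proj S v) (toTorusObservable S B)
  rw [← toTorusObservable_comp_configShift] at h
  simpa [wilsonExpectation, toTorusObservable, Function.comp_apply] using h

/-- **Zero-coupling ultralocality.** At `β = 0` the connected torus correlation of two gauge-invariant local
observables vanishes EXACTLY as soon as the torus projections of `supp A` and of `supp B + n e₀` are disjoint
(independent Haar links). [folklore] -/
theorem latticeConnectedCorr_zero_coupling {N : ℕ} (ρ : G →* Matrix (Fin N) (Fin N) ℂ) (S : ℕ) [NeZero S]
    (A B : YMSpecies G) (n : ℕ)
    (hdisj : Disjoint (A.supp.image (torusEdge S))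
      ((B.supp.image fun e : Literature.MathematicalPhysics.QuantumLattice.ZdEdge 4 =>
        (e.1 - -(Pi.single 0 (n : ℤ) : Literature.Probability.LatticeModels.Site 4), e.2)).image (torusEdge S))) :
    latticeConnectedCorr ρ 0 S A.F B.F n = 0 := by
  unfold latticeConnectedCorr
  rw [← integral_comp_configShift_torusLift ρ 0 S B.F (-Pi.single 0 (n : ℤ)),
    wilsonMeasure_zero_coupling ρ S]
  have hA : DependsOn (fun U : GaugeConfig 4 S G => A.F (torusLift S U))
      (↑(A.supp.image (torusEdge S)) : Set (Edge 4 S)) := dependsOn_comp_torusLift A.isCylinder S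
  have hB : DependsOn (fun U : GaugeConfig 4 S G =>
      B.F (configShift (-Pi.single 0 (n : ℤ)) (torusLift S U)))
      (↑((B.supp.image fun e : Literature.MathematicalPhysics.QuantumLattice.ZdEdge 4 => (e.1 - -(Pi.single 0 (n : ℤ) : Literature.Probability.LatticeModels.Site 4), e.2)).image (torusEdge S)) : Set (Edge 4 S)) :=
    dependsOn_comp_torusLift (IsCylinder.comp_configShift B.isCylinder _) S
  have hmA : Measurable fun U : GaugeConfig 4 S G => A.F (torusLift S U) :=
    A.measurable.comp (measurable_torusLift S)
  have hmB : Measurable fun U : GaugeConfig 4 S G =>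
      B.F (configShift (-Pi.single 0 (n : ℤ)) (torusLift S U)) :=
    B.measurable.comp ((configShift _).measurable.comp (measurable_torusLift S))
  rw [integral_mul_eq_of_dependsOn_disjoint (haarProbability G) _ _ hdisj hA hB hmA hmB, sub_self]

end ZeroCoupling

section ZeroCouplingTuning

variable {G : Type} [Group G] [TopologicalSpace G] [IsTopologicalGroup G] [CompactSpace G]
  [MeasurableSpace G] [BorelSpace G]

/-- Every edge in the support of the curvature species `tr F²` (the six origin plaquettes) has time coordinate
`0` or `1` at its base point. [folklore] -/
theorem curvature_supp_time (r : LatticeRep G) :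
    ∀ e ∈ r.curvature.supp, e.1 0 = 0 ∨ e.1 0 = 1 := by
  intro e he
  have he' : e ∈ Finset.univ.biUnion fun p : Fin 4 × Fin 4 => originPlaquetteSupport (d := 4) p.1 p.2 := he
  simp only [Finset.mem_biUnion, Finset.mem_univ, true_and, originPlaquetteSupport, Finset.mem_insert,
    Finset.mem_singleton] at he'
  obtain ⟨⟨i, j⟩, h | h | h | h⟩ := he' <;> subst h
  · exact Or.inl rfl
  · by_cases hi : (0 : Fin 4) = i
    · subst hi; exact Or.inr (by simp)
    · exact Or.inl (by simp [Pi.single_eq_of_ne hi])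
  · by_cases hj : (0 : Fin 4) = j
    · subst hj; exact Or.inr (by simp)
    · exact Or.inl (by simp [Pi.single_eq_of_ne hj])
  · exact Or.inl rfl

/-- For time separations `2 ≤ n ≤ S - 2` the torus projections of the curvature support and of its translate
by `n e₀` are disjoint (no shared links, no wrap-around). [folklore] -/
theorem disjoint_curvature_torusSupports (r : LatticeRep G) {S n : ℕ} (hn : 2 ≤ n) (hnS : n + 2 ≤ S) :
    Disjoint (r.curvature.supp.image (torusEdge S))
      ((r.curvature.supp.image fun e : Literature.MathematicalPhysics.QuantumLattice.ZdEdge 4 =>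
        (e.1 - -(Pi.single 0 (n : ℤ) : Literature.Probability.LatticeModels.Site 4), e.2)).image (torusEdge S)) := by
  rw [Finset.disjoint_left]
  rintro a ha hb
  rw [Finset.mem_image] at ha
  obtain ⟨e₁, he₁, rfl⟩ := ha
  simp only [Finset.mem_image] at hb
  obtain ⟨e₂', ⟨e₂, he₂, rfl⟩, heq⟩ := hb
  have h1 := curvature_supp_time r e₁ he₁
  have h2 := curvature_supp_time r e₂ he₂
  have h0 : (((e₂.1 0 + (n : ℤ) : ℤ)) : ZMod S) = ((e₁.1 0 : ℤ) : ZMod S) := by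
    have := congrArg (fun E : Edge 4 S => E.1 0) heq
    simpa [torusEdge, Literature.Probability.LatticeModels.Torus.proj] using this
  rw [ZMod.intCast_eq_intCast_iff_dvd_sub] at h0
  -- h0 : (S : ℤ) ∣ e₁.1 0 - (e₂.1 0 + n)
  have hdvd : (S : ℤ) ∣ (e₂.1 0 + n) - e₁.1 0 := dvd_sub_comm.1 h0
  have hpos : (0 : ℤ) < (e₂.1 0 + n) - e₁.1 0 := by rcases h1 with h1 | h1 <;> rcases h2 with h2 | h2 <;> omega
  have hle := Int.le_of_dvd hpos hdvd
  rcases h1 with h1 | h1 <;> rcases h2 with h2 | h2 <;> omega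

/-- **At zero coupling the tuned correlator is EXACTLY zero, eventually** (for every `M`-adic scheme): once
`2 ≤ M^{n_k} ≤ L_k`, the origin plaquettes and their translate by `M^{n_k} e₀` share no torus link, so the
product Haar measure decorrelates them. This is the left IVT endpoint `N₁(k, β = 0) = 0` that the (S)-provers
need, and it closes the `β ≡ 0` junk direction against the rev-3 statement `WithoutBeta`. [folklore] -/
theorem curvatureCorr_zero_coupling_eventually (r : LatticeRep G) (sch : SpeciesScheme (YMSpecies G))
    {M : ℕ} {n : ℕ → ℕ} (hs : ∀ k, sch.a k = ((M : ℝ) ^ n k)⁻¹) :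
    ∀ᶠ k in atTop,
      latticeConnectedCorr r.ρ 0 (sch.side k) r.curvature.F r.curvature.F (M ^ n k) = 0 := by
  have hM := two_le_of_shape sch hs
  filter_upwards [eventually_sep_le_L sch hs, (tendsto_n_of_shape sch hs).eventually_ge_atTop 1]
    with k hk hk1
  have h1 : 1 ≤ M ^ n k := Nat.one_le_pow _ _ (by omega)
  have h2 : 2 ≤ M ^ n k :=
    calc 2 ≤ M := hM
      _ = M ^ 1 := (pow_one M).symm
      _ ≤ M ^ n k := Nat.pow_le_pow_right (by omega) hk1
  refine latticeConnectedCorr_zero_coupling r.ρ (sch.side k) r.curvature r.curvature (M ^ n k)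
    (disjoint_curvature_torusSupports r h2 ?_)
  simp only [SpeciesScheme.side]
  omega

/-- Hence along any scheme whose coupling is eventually `0` the dimensionless tuned correlator tends to `0`,
so the tuning hypothesis with `θ ≠ 0` FAILS: the rev-3 statement `WithoutBeta` is not junk-refutable at
`β ≡ 0` (and, read positively, `N₁(k, 0) → 0` is the cheap half of the IVT in (S)). [folklore] -/
theorem not_tuning_of_eventually_zero_coupling (r : LatticeRep G) (sch : SpeciesScheme (YMSpecies G))
    {M : ℕ} {n : ℕ → ℕ} (hs : ∀ k, sch.a k = ((M : ℝ) ^ n k)⁻¹) (hβ : ∀ᶠ k in atTop, sch.β k = 0)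
    {θ : ℝ} (hθ : θ ≠ 0) :
    ¬ Tendsto (fun k => ((M : ℝ) ^ n k) ^ 8 *
        latticeConnectedCorr r.ρ (sch.β k) (sch.side k) r.curvature.F r.curvature.F (M ^ n k))
        atTop (𝓝 θ) := by
  intro ht
  have h0 : Tendsto (fun k => ((M : ℝ) ^ n k) ^ 8 *
      latticeConnectedCorr r.ρ (sch.β k) (sch.side k) r.curvature.F r.curvature.F (M ^ n k))
      atTop (𝓝 0) := by
    refine tendsto_const_nhds.congr' ?_
    filter_upwards [hβ, curvatureCorr_zero_coupling_eventually r sch hs] with k hk hk0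
    rw [hk, hk0, mul_zero]
  exact hθ (tendsto_nhds_unique ht h0)

end ZeroCouplingTuning

end

end Summit.QuantumFields.YangMills.Theorems.LatticeGapOnTrajectory.Negative
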